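import Summits.ValiantsHypothesis.ValiantsHypothesis.Theorems.BarrierLeverChowThinRowsForestIncidence
import Summits.ValiantsHypothesis.ValiantsHypothesis.Theorems.BarrierLeverChowThinRowsLabelledAllColumns
import Summits.ValiantsHypothesis.ValiantsHypothesis.Theorems.BarrierLeverChowThinRowsMonomialBasis

/-!
# Route BarrierLever — item `ChowHitsThinRowPartitionMinors` (stmt-ValiantsHypothesis-20195):
# the PAIR LAYER on FOREST layouts × ARBITRARY columns, every height (omnibus form + incidence)

Helper file (`--supports stmt-ValiantsHypothesis-20195`; cell valiant-natproofs, rung V4, 𝒟-side of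
door (c); prover seat val-np-p2 gen 6).  Closes NO item; imports `…ChowThinRowsForestIncidence`
(val-np-p2 g6) and val-np-p7 g4's `…ChowThinRowsLabelledAllColumns` / `…ChowThinRowsMonomialBasis`
(`exists_downClosed_monomialBasis`, `exists_good_scale`, `coeff_single_prodG`, `coeff_pair_prodG`,
`coeff_empty_prod_eqG`, `ChowSubcube.exists_forms_of_card_le`); no route file; no definitions.

**Theorem `chowHits_thinRows_of_forestCertificate`.**  Rows of size `≤ 2`, ARBITRARY injective
columns `w`, every `h ≥ 1`.  Suppose one row `u i₀` is `∅` and every other row `i` carries a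
representative vertex `rep i ∈ u i`, injectively, such that (a) a singleton row (`i ≠ i₀`) is
disjoint from every pair row, and (b) whenever the representative of a pair row `i'` is the
non-representative endpoint of a pair row `i`, then `rank (rep i') < rank (rep i)` for a ranking
`rank : Fin h → ℕ`.  Then some product of `h + h` affine forms has a nonsingular partition minor
`det [coeff (E (u i) (w j)) ∏ ℓ] ≠ 0` (item 20195's matrix verbatim).  The hypotheses say exactly:
the pair rows form a FOREST (root every tree; `rep` = child endpoint; `rank` = depth) and the
singleton rows sit off the forest.  Example outside `chowHits_thinRows_of_labelling` (p526055):
`{∅, {a,b}, {b,c}, {c,d}}` against four affinely independent columns of weight `≤ 1` — the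
down-closed monomial basis is `{∅, {p}, {q}, {t}}` and along a path of three edges a labelling
would force the two middle labels to coincide.

**Mechanism (omnibus form + incidence determinant).**  `y`-design = val-np-p7 g4's scaled
indicator forms over `PT = {singletons} ∪ Δ(W)` (`Δ(W) = {U i}` a down-closed monomial basis of
the columns, scale from `exists_good_scale`).  `x`-design: every vertex of a pair row sits on the
constant form `φ_∅` (the OMNIBUS form `1 + Σ_v x_v`), and the representative `rep i` of a row
`i ≠ i₀` sits in addition on its private form `φ_{U (σ i)}` (`σ = swap i₀ i_∅`) with coefficient
`t` (pair rows) or `1` (singleton rows).  By `coeff_single_prodG` / `coeff_pair_prodG` the pair row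
`{a,b}` of the minor is `t·(χ_a E_{L a} + χ_b E_{L b}) + t²·χ_aχ_b E_{L a,L b}` (leave-one/two-out
products), so the minor is `diag(t^{[|u i|=2]}) · (A + t·N)` where `A` is the leading matrix of
`forest_leadingMatrix_det_ne_zero` (nonsingular: incidence × truncated inverses × `B̃_ε`); then
`det (A + t·N) ≠ 0` for some `t ≠ 0` (`exists_ne_zero_det_add_smul_ne_zero`).

WHAT THIS IS NOT: pair rows forming cycles (even cycles are the first open core), two singleton
rows inside one tree (the Leibniz quadruples `{∅,a,b,ab}`) and layouts without the `∅` row are not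
treated; nothing on items 20172 / 19717, on crux stmt-ValiantsHypothesis-14610, or on `VP` vs `VNP`.
-/

set_option linter.dupNamespace false

namespace Summit.ValiantsHypothesis.ValiantsHypothesis.Theorems.BarrierLever.ChowThinAll

open Finset MvPolynomial
open Summit.ValiantsHypothesis.ValiantsHypothesis.Theorems.BarrierLever.ChowFactor
  (totalDegree_affine_le)

/-- **Forest layouts × arbitrary columns, every height** (item `ChowHitsThinRowPartitionMinors`,
stmt-ValiantsHypothesis-20195, on the layouts `∅ ∪ forest of pair rows ∪ singleton rows off the
forest`): see the module docstring.  Certificate form: `u i₀ = ∅`; `rep i ∈ u i` (`i ≠ i₀`)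
injective; a singleton row `i ≠ i₀` is disjoint from every pair row; and if the representative of
a pair row `i'` is the non-representative endpoint of a pair row `i` then
`rank (rep i') < rank (rep i)`. -/
theorem chowHits_thinRows_of_forestCertificate (h : ℕ) (hh : 1 ≤ h) {r : ℕ}
    (u w : Fin r → Finset (Fin h))
    (hw : Function.Injective w) (hu2 : ∀ i, (u i).card ≤ 2)
    (i₀ : Fin r) (hi₀ : u i₀ = ∅)
    (rep : Fin r → Fin h) (hrep : ∀ i, i ≠ i₀ → rep i ∈ u i)
    (hrinj : ∀ i i', i ≠ i₀ → i' ≠ i₀ → rep i = rep i' → i = i')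
    (hoff : ∀ i i', i ≠ i₀ → (u i).card = 1 → (u i').card = 2 → Disjoint (u i) (u i'))
    (rank : Fin h → ℕ)
    (hrank : ∀ i i', i ≠ i₀ → i' ≠ i₀ → (u i).card = 2 → (u i').card = 2 →
      rep i' ∈ u i → rep i' ≠ rep i → rank (rep i') < rank (rep i)) :
    ∃ ℓ : Fin (h + h) → MvPolynomial (Fin (h + h)) ℂ, (∀ k, (ℓ k).totalDegree ≤ 1) ∧
      (Matrix.of fun i j : Fin r => MvPolynomial.coeff
        (∑ a ∈ u i, Finsupp.single (Fin.castAdd h a) 1 +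
          ∑ c ∈ w j, Finsupp.single (Fin.natAdd h c) 1) (∏ k, ℓ k)).det ≠ 0 := by
  classical
  -- Step 0: basic counting
  have hcard_pos : ∀ i, i ≠ i₀ → 1 ≤ (u i).card := fun i hi =>
    Finset.card_pos.mpr ⟨rep i, hrep i hi⟩
  have hr : r ≤ h + 1 := by
    have hinj : Set.InjOn rep ↑((Finset.univ : Finset (Fin r)).erase i₀) := by
      intro i hi i' hi' e
      exact hrinj i i' (Finset.mem_erase.mp (Finset.mem_coe.mp hi)).1
        (Finset.mem_erase.mp (Finset.mem_coe.mp hi')).1 e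
    have h1 : ((Finset.univ : Finset (Fin r)).erase i₀).card ≤ (Finset.univ : Finset (Fin h)).card :=
      Finset.card_le_card_of_injOn rep (fun i _ => Finset.mem_coe.mpr (Finset.mem_univ _)) hinj
    rw [Finset.card_erase_of_mem (Finset.mem_univ _), Finset.card_univ, Fintype.card_fin,
      Finset.card_univ, Fintype.card_fin] at h1
    omega
  have hsingrep : ∀ i c, i ≠ i₀ → u i = {c} → rep i = c := fun i c hi hc =>
    Finset.mem_singleton.mp (by rw [← hc]; exact hrep i hi)
  have hreppair : ∀ i k a, (u i).card = 2 → a ∈ u i → k ≠ i₀ → rep k = a → (u k).card = 2 := by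
    intro i k a hi ha hk hka
    rcases Nat.lt_or_ge (u k).card 2 with hlt | hge
    · exfalso
      have hc1 : (u k).card = 1 := by have := hcard_pos k hk; omega
      have hd := hoff k i hk hc1 hi
      exact Finset.disjoint_left.mp hd (by rw [← hka]; exact hrep k hk) ha
    · exact le_antisymm (hu2 k) hge
  -- Step 1: a down-closed monomial basis `U` for the columns; the index family `PT`
  obtain ⟨U, hUinj, hUdown, hZ⟩ := exists_downClosed_monomialBasis w hw
  set PT : Finset (Finset (Fin h)) := ((Finset.univ : Finset (Fin h)).image
    fun c => ({c} : Finset (Fin h))) ∪ (Finset.univ : Finset (Fin r)).image U with hPT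
  have hsing : ∀ c : Fin h, ({c} : Finset (Fin h)) ∈ PT := fun c =>
    Finset.mem_union_left _ (Finset.mem_image.mpr ⟨c, Finset.mem_univ _, rfl⟩)
  have hUPT : ∀ i, U i ∈ PT := fun i =>
    Finset.mem_union_right _ (Finset.mem_image.mpr ⟨i, Finset.mem_univ _, rfl⟩)
  have hcard : PT.card ≤ h + h := card_singletons_union_image_le hh hr U hUinj hUdown
  -- Step 2: the scale and the `y`-parts
  obtain ⟨s, hs, hBt, -⟩ := exists_good_scale U w PT hsing hZ
  set γ : Finset (Fin h) → Fin h → ℂ :=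
    fun V c => (if V.card ≤ 1 then (1 : ℂ) else s) * (if c ∈ V then 1 else 0) with hγ
  have hγsupp : ∀ (V : Finset (Fin h)) (c : Fin h), c ∉ V → γ V c = 0 := by
    intro V c hc
    simp only [hγ, if_neg hc, mul_zero]
  have hγprod : ∀ V : Finset (Fin h), ∏ c ∈ V, γ V c ≠ 0 := by
    intro V
    refine Finset.prod_ne_zero_iff.mpr fun c hc => ?_
    simp only [hγ, if_pos hc, mul_one]
    split_ifs
    · exact one_ne_zero
    · exact hs
  have hphiE : ((C 1 + ∑ a, C ((fun (_ : Fin h) (_ : Finset (Fin h)) => (0 : ℂ)) a ∅) *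
            X (Fin.castAdd h a) + ∑ c, C (γ ∅ c) * X (Fin.natAdd h c)) : MvPolynomial (Fin (h + h)) ℂ) = 1 := by
    have h0 : ∀ c : Fin h, γ ∅ c = 0 := fun c => hγsupp ∅ c (Finset.notMem_empty c)
    simp [h0]
  -- Step 3: the index of `∅` in the basis and the matching `σ`
  obtain ⟨iE, hiE⟩ := hUdown i₀ ∅ (Finset.empty_subset _)
  set σ : Fin r ≃ Fin r := Equiv.swap i₀ iE with hσ
  have hσ0 : U (σ i₀) = ∅ := by
    rw [hσ, Equiv.swap_apply_left]
    exact hiE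
  have hσne : ∀ i, i ≠ i₀ → U (σ i) ≠ ∅ := fun i hi e =>
    hi (σ.injective (hUinj (e.trans hσ0.symm)))
  have hEPT : (∅ : Finset (Fin h)) ∈ PT := by
    rw [← hiE]
    exact hUPT iE
  -- Step 4: the vertex data: partial inverse `ι` of `rep`, labels `lab`, indicators `χ`, `ω`
  set ι : Fin h → Fin r := fun a =>
    if hx : ∃ i, i ≠ i₀ ∧ rep i = a then Classical.choose hx else i₀ with hι
  have hιrep : ∀ i, i ≠ i₀ → ι (rep i) = i := by
    intro i hi
    have hx : ∃ i', i' ≠ i₀ ∧ rep i' = rep i := ⟨i, hi, rfl⟩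
    simp only [hι, dif_pos hx]
    exact hrinj _ _ (Classical.choose_spec hx).1 hi (Classical.choose_spec hx).2
  set χ : Fin h → ℂ := fun a => if ∃ i, i ≠ i₀ ∧ rep i = a then 1 else 0 with hχ
  set lab : Fin h → Finset (Fin h) := fun a => U (σ (ι a)) with hlab
  have hlabPT : ∀ a, lab a ∈ PT := fun a => hUPT _
  have hlabU : ∀ a, ∃ k, lab a = U k := fun a => ⟨σ (ι a), rfl⟩
  have hlabrep : ∀ i, i ≠ i₀ → lab (rep i) = U (σ i) := fun i hi => by
    simp only [hlab, hιrep i hi]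
  set ω : Fin h → ℂ := fun a => if ∃ i, (u i).card = 2 ∧ a ∈ u i then 1 else 0 with hω
  have hχrep : ∀ i, i ≠ i₀ → χ (rep i) = 1 := fun i hi => by
    simp only [hχ, if_pos (⟨i, hi, rfl⟩ : ∃ i', i' ≠ i₀ ∧ rep i' = rep i)]
  have hχ0 : ∀ a, (¬ ∃ i, i ≠ i₀ ∧ rep i = a) → χ a = 0 := fun a hx => by
    simp only [hχ, if_neg hx]
  have hωpair : ∀ i a, (u i).card = 2 → a ∈ u i → ω a = 1 := fun i a hi ha => by
    simp only [hω, if_pos (⟨i, hi, ha⟩ : ∃ i', (u i').card = 2 ∧ a ∈ u i')]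
  have hωsing : ∀ i c, i ≠ i₀ → u i = {c} → ω c = 0 := by
    intro i c hi hc
    have hx : ¬ ∃ i', (u i').card = 2 ∧ c ∈ u i' := by
      rintro ⟨i', hi', hc'⟩
      have hd := hoff i i' hi (by rw [hc, Finset.card_singleton]) hi'
      rw [hc] at hd
      exact Finset.disjoint_singleton_left.mp hd hc'
    simp only [hω, if_neg hx]
  -- Step 5: the `y`-coefficients: `b`, leave-one-out `LOO`, leave-two-out `c2`, `c2u`
  obtain ⟨b, hb⟩ : ∃ b : Finset (Fin h) → ℂ, ∀ W', b W' = coeff (∑ a ∈ (∅ : Finset (Fin h)), Finsupp.single (Fin.castAdd h a) 1 +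
          ∑ c ∈ W', Finsupp.single (Fin.natAdd h c) 1)
      (∏ V ∈ PT, (C 1 + ∑ a, C ((fun (_ : Fin h) (_ : Finset (Fin h)) => (0 : ℂ)) a V) *
            X (Fin.castAdd h a) + ∑ c, C (γ V c) * X (Fin.natAdd h c))) := ⟨fun W' => _, fun _ => rfl⟩
  obtain ⟨LOO, hLOO⟩ : ∃ LOO : Finset (Fin h) → Fin r → ℂ, ∀ V j, LOO V j = coeff (∑ a ∈ (∅ : Finset (Fin h)), Finsupp.single (Fin.castAdd h a) 1 +
          ∑ c ∈ w j, Finsupp.single (Fin.natAdd h c) 1)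
      (∏ V' ∈ PT.erase V, (C 1 + ∑ a, C ((fun (_ : Fin h) (_ : Finset (Fin h)) => (0 : ℂ)) a V') *
            X (Fin.castAdd h a) + ∑ c, C (γ V' c) * X (Fin.natAdd h c))) := ⟨fun V j => _, fun _ _ => rfl⟩
  obtain ⟨c2, hc2⟩ : ∃ c2 : Finset (Fin h) → Finset (Fin h) → Fin r → ℂ, ∀ V V' j, c2 V V' j =
      coeff (∑ a ∈ (∅ : Finset (Fin h)), Finsupp.single (Fin.castAdd h a) 1 +
          ∑ c ∈ w j, Finsupp.single (Fin.natAdd h c) 1) (∏ V'' ∈ (PT.erase V).erase V', (C 1 + ∑ a, C ((fun (_ : Fin h) (_ : Finset (Fin h)) => (0 : ℂ)) a V'') *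
            X (Fin.castAdd h a) + ∑ c, C (γ V'' c) * X (Fin.natAdd h c))) := ⟨fun V V' j => _, fun _ _ _ => rfl⟩
  obtain ⟨c2u, hc2u⟩ : ∃ c2u : Fin r → Fin r → ℂ, ∀ i j, c2u i j =
      coeff (∑ a ∈ (∅ : Finset (Fin h)), Finsupp.single (Fin.castAdd h a) 1 +
          ∑ c ∈ w j, Finsupp.single (Fin.natAdd h c) 1) (∏ V'' ∈ PT \ (u i).image lab, (C 1 + ∑ a, C ((fun (_ : Fin h) (_ : Finset (Fin h)) => (0 : ℂ)) a V'') *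
            X (Fin.castAdd h a) + ∑ c, C (γ V'' c) * X (Fin.natAdd h c))) := ⟨fun i j => _, fun _ _ => rfl⟩
  -- erasing the trivial form `φ_∅` does not change the `y`-products
  have hLOOE : ∀ j, LOO ∅ j = b (w j) := by
    intro j
    rw [hLOO, hb, ← Finset.mul_prod_erase PT _ hEPT, hphiE, one_mul]
  have hc2E : ∀ V j, V ∈ PT → V ≠ ∅ → c2 V ∅ j = LOO V j ∧ c2 ∅ V j = LOO V j := by
    intro V j hV hV0
    have hmem : (∅ : Finset (Fin h)) ∈ PT.erase V := Finset.mem_erase.mpr ⟨Ne.symm hV0, hEPT⟩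
    have e1 : c2 V ∅ j = LOO V j := by
      rw [hc2, hLOO, ← Finset.mul_prod_erase (PT.erase V) _ hmem, hphiE, one_mul]
    refine ⟨e1, ?_⟩
    rw [← e1, hc2, hc2, Finset.erase_right_comm]
  -- Step 6: the leading matrix `A` (nonsingular by `forest_leadingMatrix_det_ne_zero`), the
  -- perturbation `N`, and the parameter `t`
  set A : Matrix (Fin r) (Fin r) ℂ := Matrix.of fun i j =>
    if i = i₀ then b (w j) else ∑ a ∈ u i, χ a * LOO (lab a) j with hA
  have hAdet : A.det ≠ 0 := by
    have e : A = Matrix.of fun i j : Fin r =>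
        if i = i₀ then coeff (∑ a ∈ (∅ : Finset (Fin h)), Finsupp.single (Fin.castAdd h a) 1 +
          ∑ c ∈ w j, Finsupp.single (Fin.natAdd h c) 1) (∏ V ∈ PT, (C 1 + ∑ a, C ((fun (_ : Fin h) (_ : Finset (Fin h)) => (0 : ℂ)) a V) *
            X (Fin.castAdd h a) + ∑ c, C (γ V c) * X (Fin.natAdd h c)))
        else ∑ a ∈ u i, χ a * coeff (∑ a ∈ (∅ : Finset (Fin h)), Finsupp.single (Fin.castAdd h a) 1 +
          ∑ c ∈ w j, Finsupp.single (Fin.natAdd h c) 1) (∏ V' ∈ PT.erase (lab a), (C 1 + ∑ a, C ((fun (_ : Fin h) (_ : Finset (Fin h)) => (0 : ℂ)) a V') *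
            X (Fin.castAdd h a) + ∑ c, C (γ V' c) * X (Fin.natAdd h c))) := by
      ext i j
      simp only [hA, Matrix.of_apply, hb, hLOO]
    rw [e]
    exact forest_leadingMatrix_det_ne_zero h u w hu2 i₀ rep hrep hrinj hoff rank hrank U hUinj hUdown
      PT hUPT γ hγsupp hγprod hBt σ hσ0 lab hlabrep hlabU χ hχrep hχ0
  set N : Matrix (Fin r) (Fin r) ℂ := Matrix.of fun i j =>
    if (u i).card = 2 then (∏ a ∈ u i, χ a) * c2u i j else 0 with hN
  obtain ⟨t, ht0, hAt⟩ := exists_ne_zero_det_add_smul_ne_zero A N hAdet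
  -- Step 7: the `x`-design
  set wgt : Fin h → ℂ := fun a => if (u (ι a)).card = 2 then t else 1 with hwgt
  set κ : Fin h → Finset (Fin h) → ℂ := fun a V =>
    ω a * (if V = ∅ then 1 else 0) + χ a * wgt a * (if V = lab a then 1 else 0) with hκ
  have hwgtsing : ∀ i c, i ≠ i₀ → u i = {c} → wgt c = 1 := by
    intro i c hi hc
    have e : ι c = i := by rw [← hsingrep i c hi hc]; exact hιrep i hi
    simp only [hwgt, e, hc, Finset.card_singleton]
    norm_num
  have hχwgt : ∀ i a, (u i).card = 2 → a ∈ u i → χ a * wgt a = t * χ a := by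
    intro i a hi ha
    by_cases hx : ∃ k, k ≠ i₀ ∧ rep k = a
    · obtain ⟨k, hk, hka⟩ := hx
      have e : ι a = k := by rw [← hka]; exact hιrep k hk
      have hck : (u k).card = 2 := hreppair i k a hi ha hk hka
      simp only [hwgt, e, if_pos hck]
      ring
    · rw [hχ0 a hx, zero_mul, mul_zero]
  -- Step 8: the forms and their embedding into `Fin (h + h)`
  obtain ⟨ℓ, hℓdeg, hℓprod⟩ := ChowSubcube.exists_forms_of_card_le PT hcard
    (fun V => C 1 + ∑ a, C (κ a V) * X (Fin.castAdd h a) + ∑ c, C (γ V c) * X (Fin.natAdd h c))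
    (fun V _ => by
      have e : (C 1 + ∑ a, C (κ a V) * X (Fin.castAdd h a) + ∑ c, C (γ V c) * X (Fin.natAdd h c) :
            MvPolynomial (Fin (h + h)) ℂ) =
          C 1 + ∑ v : Fin (h + h), C (Fin.append (fun a => κ a V) (fun c => γ V c) v) * X v := by
        rw [Fin.sum_univ_add]
        simp only [Fin.append_left, Fin.append_right, add_assoc]
      rw [e]
      exact totalDegree_affine_le _ _)
  refine ⟨ℓ, hℓdeg, ?_⟩
  rw [hℓprod]
  -- Step 9: sums against the `x`-design
  have hsumκ : ∀ a (f : Finset (Fin h) → ℂ),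
      ∑ V ∈ PT, κ a V * f V = ω a * f ∅ + χ a * wgt a * f (lab a) := fun a f =>
    sum_omnibus_mul PT (ω a) (χ a * wgt a) (lab a) hEPT (hlabPT a) f
  have hsumκ' : ∀ a (V₁ : Finset (Fin h)) (f : Finset (Fin h) → ℂ),
      ∑ V ∈ PT.erase V₁, κ a V * f V =
        ω a * (if V₁ = ∅ then 0 else f ∅) + χ a * wgt a * (if V₁ = lab a then 0 else f (lab a)) :=
    fun a V₁ f => sum_erase_omnibus_mul PT (ω a) (χ a * wgt a) (lab a) hEPT (hlabPT a) V₁ f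
  -- Step 10: the entries of the partition minor
  have hentry : ∀ i j, coeff (∑ a ∈ u i, Finsupp.single (Fin.castAdd h a) 1 +
          ∑ c ∈ w j, Finsupp.single (Fin.natAdd h c) 1) (∏ V ∈ PT, (C 1 + ∑ a, C (κ a V) * X (Fin.castAdd h a) + ∑ c, C (γ V c) * X (Fin.natAdd h c))) =
      (if (u i).card = 2 then t else 1) * (A i j + t * N i j) := by
    intro i j
    by_cases hi : i = i₀
    · -- the `∅` row
      subst hi
      rw [hi₀, coeff_empty_prod_eqG κ (fun _ _ => (0 : ℂ)) γ PT (w j), ← hb]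
      simp only [hA, hN, Matrix.of_apply, hi₀, Finset.card_empty]
      norm_num
    rcases Nat.lt_or_ge (u i).card 2 with h1 | h2
    · -- a singleton row `{c}` off the forest
      have hc1 : (u i).card = 1 := by have := hcard_pos i hi; omega
      obtain ⟨c, hc⟩ := Finset.card_eq_one.mp hc1
      rw [hc, coeff_single_prodG]
      have hterm : ∀ V ∈ PT, κ c V * coeff (∑ a ∈ (∅ : Finset (Fin h)), Finsupp.single (Fin.castAdd h a) 1 +
          ∑ c ∈ w j, Finsupp.single (Fin.natAdd h c) 1) (∏ V' ∈ PT.erase V, (C 1 + ∑ a, C (κ a V') * X (Fin.castAdd h a) + ∑ c, C (γ V' c) * X (Fin.natAdd h c))) = κ c V * LOO V j := by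
        intro V _
        rw [coeff_empty_prod_eqG κ (fun _ _ => (0 : ℂ)) γ (PT.erase V) (w j), hLOO]
      rw [Finset.sum_congr rfl hterm, hsumκ c (fun V => LOO V j), hωsing i c hi hc, zero_mul, zero_add,
        hwgtsing i c hi hc]
      simp only [hA, hN, Matrix.of_apply, if_neg hi, hc, Finset.card_singleton, Finset.sum_singleton]
      norm_num
    · -- a pair row `{a, a'}`
      have hci : (u i).card = 2 := le_antisymm (hu2 i) h2
      obtain ⟨a, a', haa', hia⟩ := Finset.card_eq_two.mp hci
      have ha : a ∈ u i := by rw [hia]; simp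
      have ha' : a' ∈ u i := by rw [hia]; simp
      rw [hia, coeff_pair_prodG κ γ PT haa' (w j)]
      have hterm : ∀ V ∈ PT, κ a V * coeff (∑ a ∈ ({a'} : Finset (Fin h)), Finsupp.single (Fin.castAdd h a) 1 +
          ∑ c ∈ w j, Finsupp.single (Fin.natAdd h c) 1) (∏ V' ∈ PT.erase V, (C 1 + ∑ a, C (κ a V') * X (Fin.castAdd h a) + ∑ c, C (γ V' c) * X (Fin.natAdd h c))) =
          κ a V * ∑ V' ∈ PT.erase V, κ a' V' * c2 V V' j := by
        intro V _
        rw [coeff_single_prodG κ γ (PT.erase V) a' (w j)]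
        congr 1
        refine Finset.sum_congr rfl fun V' _ => ?_
        rw [coeff_empty_prod_eqG κ (fun _ _ => (0 : ℂ)) γ ((PT.erase V).erase V') (w j), hc2]
      rw [Finset.sum_congr rfl hterm, hsumκ a (fun V => ∑ V' ∈ PT.erase V, κ a' V' * c2 V V' j),
        hsumκ' a' ∅ (fun V' => c2 ∅ V' j), hsumκ' a' (lab a) (fun V' => c2 (lab a) V' j),
        hωpair i a hci ha, hωpair i a' hci ha', hχwgt i a hci ha, hχwgt i a' hci ha']
      -- the three surviving coefficients
      have hZ1 : χ a' * (if (∅ : Finset (Fin h)) = lab a' then 0 else c2 ∅ (lab a') j) =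
          χ a' * LOO (lab a') j := by
        by_cases hx : ∃ k, k ≠ i₀ ∧ rep k = a'
        · obtain ⟨k, hk, hka⟩ := hx
          have hl : lab a' = U (σ k) := by rw [← hka]; exact hlabrep k hk
          have hne : (∅ : Finset (Fin h)) ≠ lab a' := by rw [hl]; exact (hσne k hk).symm
          rw [if_neg hne, (hc2E (lab a') j (hlabPT a') hne.symm).2]
        · rw [hχ0 a' hx, zero_mul, zero_mul]
      have hZ2 : χ a * (if lab a = ∅ then 0 else c2 (lab a) ∅ j) = χ a * LOO (lab a) j := by
        by_cases hx : ∃ k, k ≠ i₀ ∧ rep k = a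
        · obtain ⟨k, hk, hka⟩ := hx
          have hl : lab a = U (σ k) := by rw [← hka]; exact hlabrep k hk
          have hne : lab a ≠ ∅ := by rw [hl]; exact hσne k hk
          rw [if_neg hne, (hc2E (lab a) j (hlabPT a) hne).1]
        · rw [hχ0 a hx, zero_mul, zero_mul]
      have hZ3 : χ a * χ a' * (if lab a = lab a' then 0 else c2 (lab a) (lab a') j) =
          χ a * χ a' * c2u i j := by
        by_cases hx : ∃ k, k ≠ i₀ ∧ rep k = a
        · by_cases hx' : ∃ k, k ≠ i₀ ∧ rep k = a'
          · obtain ⟨k, hk, hka⟩ := hx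
            obtain ⟨k', hk', hka'⟩ := hx'
            have hl : lab a = U (σ k) := by rw [← hka]; exact hlabrep k hk
            have hl' : lab a' = U (σ k') := by rw [← hka']; exact hlabrep k' hk'
            have hkk : k ≠ k' := fun e => haa' (hka.symm.trans ((congrArg rep e).trans hka'))
            have hne : lab a ≠ lab a' := by
              rw [hl, hl']
              exact fun e => hkk (σ.injective (hUinj e))
            rw [if_neg hne, hc2, hc2u]
            have himg : (u i).image lab = {lab a, lab a'} := by
              rw [hia, Finset.image_insert, Finset.image_singleton]
            rw [himg, Finset.sdiff_insert, Finset.sdiff_singleton_eq_erase, Finset.erase_right_comm]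
          · rw [hχ0 a' hx', mul_zero, zero_mul, zero_mul]
        · rw [hχ0 a hx, zero_mul, zero_mul, zero_mul]
      have hAi : A i j = χ a * LOO (lab a) j + χ a' * LOO (lab a') j := by
        simp only [hA, Matrix.of_apply, if_neg hi, hia, Finset.sum_pair haa']
      have hNi : N i j = χ a * χ a' * c2u i j := by
        simp only [hN, Matrix.of_apply, hia, Finset.card_pair haa', Finset.prod_pair haa', if_true]
      rw [hAi, hNi]
      simp only [Finset.card_pair haa', if_true, one_mul, mul_zero, zero_add]
      linear_combination t * hZ1 + t * hZ2 + t ^ 2 * hZ3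
  -- Step 11: the determinant
  have hM : (Matrix.of fun i j : Fin r => coeff (∑ a ∈ u i, Finsupp.single (Fin.castAdd h a) 1 +
          ∑ c ∈ w j, Finsupp.single (Fin.natAdd h c) 1) (∏ V ∈ PT, (C 1 + ∑ a, C (κ a V) * X (Fin.castAdd h a) + ∑ c, C (γ V c) * X (Fin.natAdd h c)))) =
      Matrix.of fun i j : Fin r => (if (u i).card = 2 then t else 1) * (A + t • N) i j := by
    ext i j
    rw [Matrix.of_apply, Matrix.of_apply, hentry i j, Matrix.add_apply, Matrix.smul_apply, smul_eq_mul]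
  rw [hM, Matrix.det_mul_column]
  refine mul_ne_zero (Finset.prod_ne_zero_iff.mpr fun i _ => ?_) hAt
  split_ifs
  · exact ht0
  · exact one_ne_zero

end Summit.ValiantsHypothesis.ValiantsHypothesis.Theorems.BarrierLever.ChowThinAll
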